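import Summits.BirchSwinnertonDyer.BirchSwinnertonDyer.Theorems.GenusKolyvaginAtTwoMinimalTwinBSDTwoSwappedPairOneBit
import HarnessLib

/-!
# Route `GenusKolyvaginAtTwo`, crux U₂ `MinimalTwinBSDTwo` (stmt-BirchSwinnertonDyer-22985): THE SWAPPED PAIR SANDWICH WITH AN ALL-SILENT
# TWIN, ANY SIGN OF `Δ`, ANY `C(W)` — `Ш(E/K)[2^∞] = 0` whenever `ord₂ C(Wd) = ord₂ C(W)` (every prime of `d_K` silent), the K-side input of
# a swapped engine for the defect-2 cell `(Δ > 0, ord₂ C = 2)` that LINE 24's X⁼² would feed to U₂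

Seat `bsd-line-gk2-p3` g28 (PROVER seat 3/3, cell `bsd-f1-sign2`), `--supports stmt-BirchSwinnertonDyer-22985` (helper; closes nothing).
THEOREMS ONLY (no definition, no named fact, no `sorry`); standard axioms.  **BSD is NOT proved by this file; U₂ is NOT proved; no item is
closed.**  Everything here is UNCONDITIONAL (no print fact, no Kolyvagin prime, no Q2).

WHY (sequel of this seat's `…SwappedPairOneBit`, p766610, and `…TamagawaSlices`, p766209).  `closes` (rev 53) consumes U₂ on `hTw0 = (Δ > 0,
ord₂ C = 0)` (LINE 23 v1.3) and `hTw1 = (Δ < 0, ord₂ C = 1)` (p766822/p767140).  If pen bsd-idea-1's LINE 24 «strict_def2» is adopted (rev-54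
window), its exactness stub X⁼² feeds U₂ a DEFECT-2 twin on `Δ > 0`: a THIRD cell `hTw2 = (Δ > 0, ord₂ C(W) = 2)`.  On `Δ > 0` the pair sandwich
pays one archimedean bit per side, so the twin of the swapped pair must be ALL-SILENT (`ord₂ C(Wd) = ord₂ C(W)`); the budget lemmas of the tree
carry `Odd C(W)` only through the odd-case conversion (p766610 §1), so:

* §1 `prod_ncard_roots_add_one_eq_one_of_padicValNat_eq` — `ord₂ C(Wd) = ord₂ C(W)` iff every prime of `d_K` is silent:
  `∏_{q∣d_K}(1 + #roots_q) = 1` (from p766610's hT-free identity).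
* §2 **`finite_and_natCard_primaryComponent_sha_baseChange_two_eq_one_of_swappedPair_silent`** — `W/ℚ` globally minimal, ANY sign of `Δ`,
  ANY `C(W)`; `K` imaginary quadratic, `d_K` odd, Heegner for `N_W`; `E(K)[2] = 0`; `rank E(ℚ) ≥ 1`, `#Sel₂(E) = 2`; `Wd = Cd • W^(d_K)` elliptic
  with `#Sel₂(Wd) = 1` and **`ord₂ C(Wd) = ord₂ C(W)`**: then **`#Ш(E/K)[2^∞] = 1`** (finite).  Proof = g23's p764716 / this seat's p766610
  verbatim with BOTH relaxed indices bounded by the archimedean form of the model-free core (`relIndex_sha_comap_resBaseChange_le_of_arch` +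
  pen g12's `archimedeanBit_sha_comap_resBaseChange`: `≤ 2 · ∏ #X(ℚ_q)[2] = 2`).  `…_silent'`: `E(K)[2] = 0` discharged from `#Sel₂(E) = 2`.
  At `C(W)` odd on `Δ > 0` this is g23's `ord₂ C(Wd) = 0` branch; at `ord₂ C(W) = 2` it is the K-side exactness input for `hTw2`.

Sequel (`…SwappedPairSilentDescent`): the `ε = −1` descent at depth `ord₂ c + ord₂ C(W)` with a silent twin, any sign, and the census
composition `hTw2 ⟸ S1 + S2⁼ + PRINT`.  BSD is NOT proved; nothing is closed.

References: [Kramer1981] Thm. 1, §2 Prop. 3, Prop. 6; [GrossLMS1991] §5 (5.1)–(5.3); [MilneADT2006] I Rem. 3.7, Thm. 6.13;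
[SilvermanAEC2009] X.4.2, X.5 Cor. 5.4, Exercise 10.16.
-/

set_option autoImplicit false
set_option linter.dupNamespace false -- `Summit.<P>.<Sub>` repeats `BirchSwinnertonDyer` (D-0017)

noncomputable section

open scoped Classical

namespace Summit.BirchSwinnertonDyer.BirchSwinnertonDyer.Theorems.GenusExact.TwinSwap.Silent

open Literature.NumberTheory.EllipticCurves Literature.NumberTheory.GaloisRepresentations WeierstrassCurve NumberField
  IsDedekindDomain Field AddSubgroup
open Summit.BirchSwinnertonDyer.Rank1Residual Literature.Barriers.BirchSwinnertonDyer
open Summit.BirchSwinnertonDyer.BirchSwinnertonDyer.Theorems.GenusExact.PlusDescent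
open Summit.BirchSwinnertonDyer.BirchSwinnertonDyer.Theorems.GenusExact.TwinSwap
open Summit.BirchSwinnertonDyer.BirchSwinnertonDyer.Theorems.GenusExact.TwinSwap.OneBit
open Summit.BirchSwinnertonDyer.BirchSwinnertonDyer.Theorems.GenusExact.RegularPlusDescent (archimedeanBit_sha_comap_resBaseChange
  relIndex_sha_comap_resBaseChange_le_of_arch)

/-! ## §1 All primes of `d_K` silent iff `ord₂ C(Wd) = ord₂ C(W)` -/

section Budget

variable (W : WeierstrassCurve ℚ) [W.IsElliptic] [W.IsGloballyMinimal]
  {K : Type} [Field K] [NumberField K]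

/-- **`ord₂ C(Wd) = ord₂ C(W)` ⟹ `∏_{q ∣ d_K} (#roots_q + 1) = 1`** (every prime of `d_K` is silent: the `2`-division cubic of `W` has no root
mod `q`).  From this seat's hT-free identity `(∏ (#roots_q + 1)) · 2^{ord₂ C(W)} = 2^{ord₂ C(Wd)}` (p766610); no parity hypothesis on `C(W)`.
[cite: Kramer1981, §2 Prop. 3] -/
theorem prod_ncard_roots_add_one_eq_one_of_padicValNat_eq (hK : IsImaginaryQuadratic K)
    (hodd : Odd (NumberField.discr K)) (hH : SatisfiesHeegnerHypothesis (W.conductorNorm ℤ) K)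
    {Wd : WeierstrassCurve ℚ} [Wd.IsElliptic] (Cd : VariableChange ℚ) (hWd : Cd • W.quadraticTwist (NumberField.discr K : ℚ) = Wd)
    (hSil : padicValNat 2 Wd.tamagawaProduct = padicValNat 2 W.tamagawaProduct) :
    ∏ q ∈ (NumberField.discr K).natAbs.primeFactors,
        ({x : ZMod q | 4 * x ^ 3 + ((integralModelInt W).b₂ : ZMod q) * x ^ 2 +
          2 * ((integralModelInt W).b₄ : ZMod q) * x + ((integralModelInt W).b₆ : ZMod q) = 0}.ncard + 1) = 1 := by
  have h := prod_ncard_roots_add_one_mul_eq_two_pow_padicValNat_tamagawaProduct_twin W hK hodd hH Cd hWd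
  rw [hSil] at h
  have hpos : 0 < 2 ^ padicValNat 2 W.tamagawaProduct := Nat.pos_of_ne_zero (pow_ne_zero _ two_ne_zero)
  exact Nat.eq_of_mul_eq_mul_right hpos (by rw [one_mul]; exact h)

end Budget

/-! ## §2 The swapped pair sandwich with an all-silent twin (any sign of `Δ`, no parity hypothesis on `C(W)`) -/

section Swapped

variable (W : WeierstrassCurve ℚ) [W.IsElliptic] [W.IsGloballyMinimal]
variable (K : Type) [Field K] [NumberField K]

/-- **THE SWAPPED PAIR SANDWICH WITH AN ALL-SILENT TWIN (any sign, any `C(W)`).**  `W/ℚ` globally minimal; `K` imaginary quadratic, `d_K`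
odd, Heegner for `N_W`; `E(K)[2] = 0`; `rank E(ℚ) ≥ 1` and `#Sel₂(E/ℚ) = 2`; `Wd = Cd • W^(d_K)` elliptic with `#Sel₂(Wd/ℚ) = 1` and the SILENT
budget **`ord₂ C(Wd) = ord₂ C(W)`**.  Then `Ш(E/K)[2^∞]` is finite and **`#Ш(E/K)[2^∞] = 1`**.  Proof = gk2-p2 g23's p764716 / this seat's p766610
verbatim — base `T₀ = W^(d_K)` (rank `0`, `Ш(T₀/ℚ)[2^∞] = 0`), twist `T₀^(d_K) = D • W` (rank `1`, `Ш[2^∞] = 0`), frame point = twist of a rational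
point of infinite order, gk2-p3 g27's `natCard_sha_dvd_pow_of_pair_of_frame`, twist transport `Ψ` — with BOTH relaxed indices bounded by the
ARCHIMEDEAN form of the model-free core (`relIndex_sha_comap_resBaseChange_le_of_arch` with pen g12's `archimedeanBit_sha_comap_resBaseChange`:
`≤ 2 · ∏_{q∣d_K} #X(ℚ_q)[2] = 2 · 1`).  Unconditional.
[cite: Kramer1981, Thm. 1, §2 Prop. 3, Prop. 6] [cite: GrossLMS1991, §5 (5.1)–(5.3)] [cite: SilvermanAEC2009, X.5 Cor. 5.4, Exercise 10.16, Thm. X.4.2] -/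
theorem finite_and_natCard_primaryComponent_sha_baseChange_two_eq_one_of_swappedPair_silent
    (hIQ : IsImaginaryQuadratic K) (hodd : Odd (NumberField.discr K))
    (hHe : SatisfiesHeegnerHypothesis (W.conductorNorm ℤ) K)
    (h2K : ∀ P : (W.baseChange K).toAffine.Point, (2 : ℤ) • P = 0 → P = 0)
    (hrk : 1 ≤ W.mordellWeilRank) (hSel : Nat.card (W.selmerGroup 2) = 2)
    {Wd : WeierstrassCurve ℚ} [Wd.IsElliptic] (Cd : VariableChange ℚ) (hWd : Cd • W.quadraticTwist (NumberField.discr K : ℚ) = Wd)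
    (hSel1 : Nat.card (Wd.selmerGroup 2) = 1)
    (hSil : padicValNat 2 Wd.tamagawaProduct = padicValNat 2 W.tamagawaProduct) :
    Finite (AddCommGroup.primaryComponent (↥(W.baseChange K).sha) 2) ∧
      Nat.card (AddCommGroup.primaryComponent (↥(W.baseChange K).sha) 2) = 1 := by
  haveI : Fact (Nat.Prime 2) := ⟨Nat.prime_two⟩
  haveI : NeZero (2 : ℚ) := ⟨two_ne_zero⟩
  have h2 : Module.finrank ℚ K = 2 := hIQ.1
  have hdK : (NumberField.discr K : ℚ) ≠ 0 := by exact_mod_cast NumberField.discr_ne_zero K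
  haveI hT₀ell : (W.quadraticTwist (NumberField.discr K : ℚ)).IsElliptic := W.isElliptic_quadraticTwist hdK
  haveI hX'ell : ((W.quadraticTwist (NumberField.discr K : ℚ)).quadraticTwist (NumberField.discr K : ℚ)).IsElliptic :=
    (W.quadraticTwist (NumberField.discr K : ℚ)).isElliptic_quadraticTwist hdK
  haveI hT₀Kell : ((W.quadraticTwist (NumberField.discr K : ℚ)).baseChange K).IsElliptic :=
    inferInstanceAs (((W.quadraticTwist (NumberField.discr K : ℚ)).map (algebraMap ℚ K)).IsElliptic)
  -- the one-bit budget in root-count currency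
  set P : ℕ := ∏ q ∈ (NumberField.discr K).natAbs.primeFactors,
        ({x : ZMod q | 4 * x ^ 3 + ((integralModelInt W).b₂ : ZMod q) * x ^ 2 +
          2 * ((integralModelInt W).b₄ : ZMod q) * x + ((integralModelInt W).b₆ : ZMod q) = 0}.ncard + 1) with hPdef
  have hP1 : P = 1 := prod_ncard_roots_add_one_eq_one_of_padicValNat_eq W hIQ hodd hHe Cd hWd hSil
  -- `X' = T₀^(d_K) = D • W`, `Aut(K/ℚ) = {1, τ}`, `θ = √d_K`
  obtain ⟨D, hD⟩ := exists_quadraticTwist_quadraticTwist_eq_smul W hdK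
  obtain ⟨τ, θ, hτ1, hθQ, hθ2, hτθ, -⟩ := exists_gal_ne_one_sqrt_discr K h2
  -- ### (a) the rank-one member: `rank E(ℚ) = 1`, a rational point of infinite order, `#Sel₂(X') = 2`, `Ш(X'/ℚ)[2^∞] = 0`
  obtain ⟨hrkW1, -, -⟩ := rank_eq_one_and_sha_primary_eq_zero_of_natCard_selmerGroup_eq_two W hSel hrk
  obtain ⟨Q, hQ⟩ := exists_not_isOfFinAddOrder_of_one_le_mordellWeilRank W hrk
  have hSelX : Nat.card (((W.quadraticTwist (NumberField.discr K : ℚ)).quadraticTwist (NumberField.discr K : ℚ)).selmerGroup 2) = 2 := by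
    have h := natCard_selmerGroup_smul W D (n := 2) two_ne_zero
    simp only [Nat.cast_ofNat] at h
    rw [← hD] at h
    exact h.trans hSel
  have hrkX : ((W.quadraticTwist (NumberField.discr K : ℚ)).quadraticTwist (NumberField.discr K : ℚ)).mordellWeilRank = 1 := by
    have h : (D • W).mordellWeilRank = W.mordellWeilRank := mordellWeilRank_variableChange_holds W D
    rw [← hD] at h
    rw [h, hrkW1]
  obtain ⟨-, -, hT0⟩ := rank_eq_one_and_sha_primary_eq_zero_of_natCard_selmerGroup_eq_two
    ((W.quadraticTwist (NumberField.discr K : ℚ)).quadraticTwist (NumberField.discr K : ℚ)) hSelX (by rw [hrkX])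
  -- ### (b) the base `T₀`: `#Sel₂(T₀) = 1`, rank `0`, `Ш(T₀/ℚ)[2^∞] = 0`
  have hSelT : Nat.card ((W.quadraticTwist (NumberField.discr K : ℚ)).selmerGroup ((2 : ℕ) : ℤ)) = 1 := by
    have h := natCard_selmerGroup_smul (W.quadraticTwist (NumberField.discr K : ℚ)) Cd (n := 2) two_ne_zero
    rw [hWd] at h
    rw [← h, Nat.cast_ofNat]
    exact hSel1
  obtain ⟨hrkT0, -, -⟩ := rank_eq_zero_and_torsionBy_eq_bot_and_sha_inf_torsionBy_eq_bot_of_natCard_selmerGroup_eq_one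
    (W.quadraticTwist (NumberField.discr K : ℚ)) 2 hSelT
  have hbotT : AddCommGroup.primaryComponent (↥(W.quadraticTwist (NumberField.discr K : ℚ)).sha) 2 = ⊥ :=
    primaryComponent_sha_eq_bot_of_natCard_selmerGroup_eq_one (W.quadraticTwist (NumberField.discr K : ℚ)) 2 hSelT
  haveI hfinT : Finite (AddCommGroup.primaryComponent (↥(W.quadraticTwist (NumberField.discr K : ℚ)).sha) 2) := by
    rw [hbotT]; infer_instance
  have hexp : ∀ a ∈ AddCommGroup.primaryComponent (↥(W.quadraticTwist (NumberField.discr K : ℚ)).sha) 2, 2 ^ 0 • a = 0 := by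
    intro a ha
    rw [hbotT, AddSubgroup.mem_bot] at ha
    rw [ha, smul_zero]
  have h4 : Nat.card (AddSubgroup.torsionBy (↥(W.quadraticTwist (NumberField.discr K : ℚ)).sha) ((2 : ℕ) : ℤ)) ≤ 4 := by
    have h1 : Nat.card (AddSubgroup.torsionBy (↥(W.quadraticTwist (NumberField.discr K : ℚ)).sha) ((2 : ℕ) : ℤ)) = 1 := by
      rw [Nat.card_eq_one_iff_unique]
      refine ⟨⟨fun a b ↦ Subtype.ext ?_⟩, ⟨0⟩⟩
      have hmem : ∀ c : AddSubgroup.torsionBy (↥(W.quadraticTwist (NumberField.discr K : ℚ)).sha) ((2 : ℕ) : ℤ),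
          (c : ↥(W.quadraticTwist (NumberField.discr K : ℚ)).sha) = 0 := by
        intro c
        have hc : (c : ↥(W.quadraticTwist (NumberField.discr K : ℚ)).sha) ∈
            AddCommGroup.primaryComponent (↥(W.quadraticTwist (NumberField.discr K : ℚ)).sha) 2 :=
          (AddCommGroup.mem_primaryComponent).2 ⟨1, by rw [pow_one, ← natCast_zsmul]; exact mem_torsionBy_iff.mp c.2⟩
        rwa [hbotT, AddSubgroup.mem_bot] at hc
      rw [hmem a, hmem b]
    omega
  -- ### (c) the frame of `T₀ ⊗ K`: no `2`-torsion, rank `≤ 1`, the anti-invariant point of infinite order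
  have hrkTK : ((W.quadraticTwist (NumberField.discr K : ℚ)).baseChange K).mordellWeilRank ≤ 1 := by
    haveI : Module.Finite ℤ ((W.quadraticTwist (NumberField.discr K : ℚ)).baseChange K).toAffine.Point :=
      ((W.quadraticTwist (NumberField.discr K : ℚ)).baseChange K).module_finite_point_holds
    rw [(W.quadraticTwist (NumberField.discr K : ℚ)).mordellWeilRank_baseChange_of_finrank_eq_two_of_finite K h2, hrkT0, hrkX]
  obtain ⟨C₁, hC₁⟩ := W.exists_variableChange_quadraticTwist_one
  have h2torsT : ∀ P : ((W.quadraticTwist (NumberField.discr K : ℚ)).baseChange K).toAffine.Point, (2 : ℤ) • P = 0 → P = 0 := by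
    intro P hP
    let eK : ((W.quadraticTwist (NumberField.discr K : ℚ)).baseChange K).toAffine.Point ≃+ (W.baseChange K).toAffine.Point :=
      ((VariableChange.pointEquiv ((W.quadraticTwist (NumberField.discr K : ℚ)).baseChange K) (twistUntwist hθQ)).trans
        (Affine.Point.congrEquiv (twistUntwist_smul_baseChange W hθQ hθ2))).trans
        ((Affine.Point.congrEquiv (congrArg (fun V : WeierstrassCurve ℚ ↦ V.baseChange K) hC₁.symm)).trans
          (VariableChange.pointEquivBaseChange W C₁ K).symm)
    have h := h2K (eK P) (by rw [← map_zsmul, hP, map_zero])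
    exact eK.injective (h.trans (map_zero eK).symm)
  -- the frame point: the twist of `Q`, anti-invariant of infinite order
  have hτθ' : (τ : K →ₐ[ℚ] K) θ = -θ := hτθ
  obtain ⟨y, hy_inf, hyanti⟩ := exists_antiInvariant_twist_point_of_not_isOfFinAddOrder W hθQ hθ2 hdK hτθ' hQ
  have hanti : IsOfFinAddOrder (Affine.Point.map (W' := W.quadraticTwist (NumberField.discr K : ℚ)) (τ : K →ₐ[ℚ] K) y + y) := by
    rw [hyanti, neg_add_cancel]
    exact IsOfFinAddOrder.zero
  haveI : Module.Finite ℤ ((W.quadraticTwist (NumberField.discr K : ℚ)).baseChange K).toAffine.Point :=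
    ((W.quadraticTwist (NumberField.discr K : ℚ)).baseChange K).module_finite_point_holds
  obtain ⟨M, -, hndiv'⟩ := exists_pow_smul_eq_and_not_of_not_isOfFinAddOrder Nat.prime_two hy_inf
  have hndiv : ∀ Q' : ((W.quadraticTwist (NumberField.discr K : ℚ)).baseChange K).toAffine.Point, ((2 ^ (M + 1) : ℕ) : ℤ) • Q' ≠ y :=
    fun Q' h ↦ hndiv' ⟨Q', h⟩
  -- ### (d) the two budgets, BOTH by the model-free core, in root-count currency (no parity of `C(W)` needed)
  -- local `2`-torsion counts of `W` at a prime `q ∣ d_K`: `#W(ℚ_q)[2] = 1 + #roots_q`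
  have hcountW : ∀ p ∈ (NumberField.discr K).natAbs.primeFactors,
      Nat.card {P : (W.baseChange ((Matsuno2009.primePlace p).adicCompletion ℚ)).toAffine.Point // 2 • P = 0} =
        {x : ZMod p | 4 * x ^ 3 + ((integralModelInt W).b₂ : ZMod p) * x ^ 2 +
          2 * ((integralModelInt W).b₄ : ZMod p) * x + ((integralModelInt W).b₆ : ZMod p) = 0}.ncard + 1 := by
    intro p hp
    obtain ⟨hpr, hpdvd, -⟩ := Nat.mem_primeFactors.mp hp
    have hpd : (p : ℤ) ∣ NumberField.discr K := Int.natCast_dvd.mpr hpdvd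
    have hp2 : p ≠ 2 := by
      rintro rfl
      obtain ⟨r, hr⟩ := hodd
      omega
    haveI := Fact.mk hpr
    rw [natCard_twoTorsion_adicCompletion_eq_padic W (Matsuno2009.primePlace p) (Matsuno2009.natCast_mem_primePlace hpr)]
    exact GenusKolyTwin.natCard_twoTorsion_padic_eq W hp2
      (not_dvd_minimalDiscriminantInt_of_dvd_discr_of_heegner W K hIQ.1 hHe hpr hp2 hpd)
  have hprodT : ∏ p ∈ (NumberField.discr K).natAbs.primeFactors,
      Nat.card {P : ((W.quadraticTwist (NumberField.discr K : ℚ)).baseChange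
        ((Matsuno2009.primePlace p).adicCompletion ℚ)).toAffine.Point // 2 • P = 0} = P := by
    refine Finset.prod_congr rfl fun p hp ↦ ?_
    obtain ⟨hpr, -, -⟩ := Nat.mem_primeFactors.mp hp
    haveI := Fact.mk hpr
    haveI : CharZero ((Matsuno2009.primePlace p).adicCompletion ℚ) :=
      charZero_of_injective_algebraMap (algebraMap ℚ _).injective
    rw [natCard_twoTorsion_baseChange_twin_eq W (W.quadraticTwist (NumberField.discr K : ℚ)) hdK 1 (one_smul _ _)]
    exact hcountW p hp
  have hprodX : ∏ p ∈ (NumberField.discr K).natAbs.primeFactors,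
      Nat.card {P : (((W.quadraticTwist (NumberField.discr K : ℚ)).quadraticTwist (NumberField.discr K : ℚ)).baseChange
        ((Matsuno2009.primePlace p).adicCompletion ℚ)).toAffine.Point // 2 • P = 0} = P := by
    refine Finset.prod_congr rfl fun p hp ↦ ?_
    obtain ⟨hpr, -, -⟩ := Nat.mem_primeFactors.mp hp
    haveI := Fact.mk hpr
    rw [natCard_twoTorsion_baseChange_eq_of_smul D hD ((Matsuno2009.primePlace p).adicCompletion ℚ)]
    exact hcountW p hp
  -- the base `T₀ = 1 • W^(d_K)`: good at the non-split primes off `d_K`; archimedean form of the model-free budget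
  have hgoodT : ∀ p : ℕ, p.Prime → ¬ (p : ℤ) ∣ NumberField.discr K → ((Ideal.span {(p : ℤ)}).primesOver (𝓞 K)).ncard ≠ 2 →
      (W.quadraticTwist (NumberField.discr K : ℚ)).HasGoodReductionAt (Matsuno2009.primePlace p) :=
    fun _ hp hpd hns ↦ hasGoodReductionAt_primePlace_twin_of_ncard_ne_two W K h2 hodd hHe
      (Wd := W.quadraticTwist (NumberField.discr K : ℚ)) 1 (one_smul _ _) hp hpd hns
  obtain ⟨hneT, hleT⟩ := relIndex_sha_comap_resBaseChange_le_of_arch K (W.quadraticTwist (NumberField.discr K : ℚ)) h2 hodd hgoodT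
    (archimedeanBit_sha_comap_resBaseChange (W.quadraticTwist (NumberField.discr K : ℚ)) K)
  rw [hprodT, hP1, mul_one] at hleT
  -- the twist `X' = D • W`: good at the non-split primes off `d_K`; archimedean form of the model-free budget
  have hgoodX : ∀ p : ℕ, p.Prime → ¬ (p : ℤ) ∣ NumberField.discr K → ((Ideal.span {(p : ℤ)}).primesOver (𝓞 K)).ncard ≠ 2 →
      ((W.quadraticTwist (NumberField.discr K : ℚ)).quadraticTwist (NumberField.discr K : ℚ)).HasGoodReductionAt (Matsuno2009.primePlace p) := by
    intro p hp _ hns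
    rw [hD]
    exact (hasGoodReductionAt_smul_iff_holds (Matsuno2009.primePlace p) W D).mpr
      (hasGoodReductionAt_primePlace_of_ncard_ne_two W K hHe hp hns)
  obtain ⟨hneX, hleX⟩ := relIndex_sha_comap_resBaseChange_le_of_arch K
    ((W.quadraticTwist (NumberField.discr K : ℚ)).quadraticTwist (NumberField.discr K : ℚ)) h2 hodd hgoodX
    (archimedeanBit_sha_comap_resBaseChange _ K)
  rw [hprodX, hP1, mul_one] at hleX
  have hbud4 :
      ((W.quadraticTwist (NumberField.discr K : ℚ)).sha).relIndex
          ((((W.quadraticTwist (NumberField.discr K : ℚ)).baseChange K).sha).comap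
            (resBaseChange (W.quadraticTwist (NumberField.discr K : ℚ)) K)) *
        (((W.quadraticTwist (NumberField.discr K : ℚ)).quadraticTwist (NumberField.discr K : ℚ)).sha).relIndex
          (((((W.quadraticTwist (NumberField.discr K : ℚ)).quadraticTwist (NumberField.discr K : ℚ)).baseChange K).sha).comap
            (resBaseChange ((W.quadraticTwist (NumberField.discr K : ℚ)).quadraticTwist (NumberField.discr K : ℚ)) K)) ≤ 4 :=
    calc _ ≤ 2 * 2 := Nat.mul_le_mul hleT hleX
      _ = 4 := by norm_num
  -- ### (e) the sandwich for the base `T₀`: `#Ш(T₀/K)[2^∞] ∣ 4^0`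
  obtain ⟨hfinTK, hdvd⟩ := natCard_sha_dvd_pow_of_pair_of_frame (W.quadraticTwist (NumberField.discr K : ℚ)) K hIQ hτ1 h2torsT
    hrkTK y M hndiv hanti hT0 hneT hneX hbud4 hexp h4
  rw [mul_zero, pow_zero, Nat.dvd_one] at hdvd
  -- ### (f) transport along `Ψ : H¹(K, T₀) ≃ H¹(K, E)`
  haveI := hfinTK
  obtain ⟨Ψ, hΨ, -, -, -⟩ := exists_galH1_twistTransport W K h2 hθQ hθ2 τ hτ1
  obtain ⟨hfin, hcard⟩ := finite_and_natCard_primaryComponent_eq_of_addEquiv Ψ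
    (((W.quadraticTwist (NumberField.discr K : ℚ)).baseChange K).sha) ((W.baseChange K).sha) hΨ 2
  exact ⟨hfin, hcard.trans hdvd⟩

/-- **The same, all inputs on the `ℚ`-side** (`E(K)[2] = 0` discharged: `#Sel₂(E) = 2` with `rank E(ℚ) ≥ 1` gives `E(ℚ)[2] = 0`, hence
`E(K)[2] = 0` by g23's `forall_two_zsmul_baseChange_eq_zero_of_heegner`).  `W/ℚ` globally minimal (any sign of `Δ`, any `C(W)`); `K` imaginary
quadratic, `d_K` odd, Heegner for `N_W`; `rank E(ℚ) ≥ 1`, `#Sel₂(E) = 2`; `Wd = Cd • W^(d_K)` elliptic with `#Sel₂(Wd) = 1` and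
`ord₂ C(Wd) = ord₂ C(W)`.  Then **`#Ш(E/K)[2^∞] = 1`** (finite).  On `C(W)` odd, `Δ > 0` this is g23's `ord₂ C(Wd) = 0` branch; on the defect-2
cell `(Δ > 0, ord₂ C(W) = 2)` it is the K-side exactness input of a depth-`(ord₂ c + 2)` swapped line.  Unconditional.
[cite: Kramer1981, Thm. 1, §2 Prop. 3, Prop. 6] [cite: GrossLMS1991, §5 (5.1)–(5.3)] [cite: SilvermanAEC2009, X.5 Cor. 5.4, Thm. X.4.2] -/
theorem natCard_primaryComponent_sha_baseChange_two_eq_one_of_swappedPair_silent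
    (hIQ : IsImaginaryQuadratic K) (hodd : Odd (NumberField.discr K))
    (hHe : SatisfiesHeegnerHypothesis (W.conductorNorm ℤ) K)
    (hrk : 1 ≤ W.mordellWeilRank) (hSel : Nat.card (W.selmerGroup 2) = 2)
    {Wd : WeierstrassCurve ℚ} [Wd.IsElliptic] (Cd : VariableChange ℚ) (hWd : Cd • W.quadraticTwist (NumberField.discr K : ℚ) = Wd)
    (hSel1 : Nat.card (Wd.selmerGroup 2) = 1)
    (hSil : padicValNat 2 Wd.tamagawaProduct = padicValNat 2 W.tamagawaProduct) :
    Finite (AddCommGroup.primaryComponent (↥(W.baseChange K).sha) 2) ∧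
      Nat.card (AddCommGroup.primaryComponent (↥(W.baseChange K).sha) 2) = 1 := by
  obtain ⟨-, hT2, -⟩ := rank_eq_one_and_sha_primary_eq_zero_of_natCard_selmerGroup_eq_two W hSel hrk
  exact finite_and_natCard_primaryComponent_sha_baseChange_two_eq_one_of_swappedPair_silent W K hIQ hodd hHe
    (forall_two_zsmul_baseChange_eq_zero_of_heegner W K hIQ hodd hHe (fun P hP ↦ by convert hT2 P (by convert hP)))
    hrk hSel Cd hWd hSel1 hSil

end Swapped

end Summit.BirchSwinnertonDyer.BirchSwinnertonDyer.Theorems.GenusExact.TwinSwap.Silent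

end
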